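import Summits.QuantumFields.YangMills.Theses.FirstExitWindow
import Literature.MathematicalPhysics.QuantumFieldTheory.Balaban1983to89.T3Thresholds
import Literature.MathematicalPhysics.QuantumFieldTheory.Balaban1983to89.T3ThresholdSmallness
import Literature.MathematicalPhysics.QuantumFieldTheory.Balaban1983to89.BlockAveragingPlaquetteBound

/-!
# Route `FirstExitWindow` (QuantumFields / YangMills; rung-R3 leaf `T3YM3TorusStatement.YM3TorusSU2`) — THE WINDOW
# `OneStepWindowL` (support item stmt-QuantumFields-26244), PROVED

WHAT THIS IS NOT: not a probability bound and not a proof of the route's crux `FirstExitWindowTailL` (stmt-QuantumFields-26243); nothing bears on the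
Yang–Mills mass gap, and the rung R3 (`YM3TorusSU2`, a RECORD rung, not the Clay statement) stays open.  It is the route's DETERMINISTIC input, one
configuration at a time: for every block size `L` and profile `(b₀, p₀)` (`0 < b₀`, `2 < p₀`) there are a wider constant `b₂ ≥ b₀` and a coupling
threshold `γ₁ ∈ (0, 1]` such that for every family of block size `L`, every `0 < γ ≤ γ₁`, every run `K`, every level `j` with `j + 1 ≤ K` and EVERY
fine configuration `U`: if all plaquettes of the `j`-fold (0.4)-average `Ū^{j}` are `< θ_{b₀}(K−j)`, then all plaquettes of `Ū^{j+1}` are `< θ_{b₂}(K−j−1)`.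

THE ARGUMENT (all pieces landed in the Literature tree).
* `b₂ = W(L)·b₀` with the one-step window factor `W(L) = L² + 6·(5L)²` of the tree's crude form of [Balaban1985Averaging] Prop. 1 for the (0.4) averaging
  with `exp[mean log]` on `SU(2)` (`BlockAveragingPlaquetteBound.plaqSmall_blockAvg_expMeanLogSU`: `PlaqSmall a U ⇒ PlaqSmall (W·a) (blockAvg ℰp U)` under the
  guard `((5L)²/4)·a < δ_{SU(2)}`, standing range `j + 1 ≤ m + K`);
* `γ₁ = min γ_w (min e^{2(1−p₀)} 1)`, where below `γ_w` every threshold satisfies `θ_{b₀}(i) ≤ δ_{SU(2)}/(5L)²` (`T3ThresholdSmallness.exists_forall_θBal_le`), so the guard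
  holds at `a = θ_{b₀}(K−j)`, and below `e^{2(1−p₀)}` the thresholds SHRINK away from the unit scale (`T3Thresholds.θBal_succ_le`: `θ(i+1) ≤ θ(i)`), so that
  `W·θ_{b₀}(K−j) ≤ W·θ_{b₀}(K−j−1) = θ_{W b₀}(K−j−1)` (`θ` is linear in `b`).
The degenerate block sizes `L = 0` carry no family (`1 < F.L`), so any constants do.

References: T. Bałaban, CMP 98 (1985) 17–51 [Balaban1985Averaging] (Prop. 1 (51) p.26); CMP 102 (1985) 255–275 [Balaban1985UV3] ((7) p.257);
CMP 109 (1987) 249–301 [Balaban1987RG1] ((0.4) p.253).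
-/

noncomputable section

open Literature.MathematicalPhysics.QuantumFieldTheory.Balaban1983to89
open Literature.MathematicalPhysics.QuantumFieldTheory.Balaban1983to89.T3ContinuumYM3Torus
open Literature.MathematicalPhysics.QuantumFieldTheory.Balaban1983to89.T3UnitScaleTilt
open Literature.MathematicalPhysics.QuantumFieldTheory.Balaban1983to89.T3UnitLawDensityEML (ℰp)
open Literature.MathematicalPhysics.QuantumFieldTheory.Balaban1983to89.T3Thresholds (θBal_eq θBal_succ_le sqrt_le_exp_iff)
open Literature.MathematicalPhysics.QuantumFieldTheory.Balaban1983to89.T3ThresholdSmallness (exists_forall_θBal_le)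
open Literature.MathematicalPhysics.QuantumFieldTheory.Balaban1983to89.T3MinimiserStabilityReduction (θBal_pos)
open Literature.MathematicalPhysics.QuantumFieldTheory.Balaban1983to89.ExpMeanLog (expMeanLogSU deltaSU deltaSU_pos)
open Literature.MathematicalPhysics.QuantumFieldTheory.Balaban1983to89.BlockAveragingPlaquetteBound (plaqSmall_blockAvg_expMeanLogSU)

namespace Summit.QuantumFields.YangMills.Theorems

namespace OneStepWindowL

/-- Bałaban's thresholds are linear in the profile constant `b`: `θ_{c·b₀}(i) = c·θ_{b₀}(i)` (`p(g) = b₀(1 + log g⁻¹)^{p₀}`). [cite: Balaban1985UV3, (7) p.257] -/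
theorem θBal_const_mul (L : ℕ) (γ c b₀ p₀ : ℝ) (i : ℕ) : θBal L γ (c * b₀) p₀ i = c * θBal L γ b₀ p₀ i := by
  rw [θBal_eq, θBal_eq]
  unfold B10.pFun
  ring

/-- The one-step window factor `W(L) = L² + 6·(5L)²` of the crude Prop. 1 is at least `1` for `L ≥ 1`. [cite: Balaban1985Averaging, Prop. 1 (51) p.26] -/
theorem one_le_windowFactor {L : ℕ} (hL : 1 ≤ L) : (1 : ℝ) ≤ (L : ℝ) ^ 2 + 6 * (((3 + 2) * L : ℕ) : ℝ) ^ 2 := by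
  have hL' : (1 : ℝ) ≤ L := by exact_mod_cast hL
  have h5 : (0 : ℝ) ≤ (((3 + 2) * L : ℕ) : ℝ) ^ 2 := sq_nonneg _
  nlinarith

end OneStepWindowL

open OneStepWindowL

/-- **THE WINDOW `OneStepWindowL` OF ROUTE `FirstExitWindow` (support item stmt-QuantumFields-26244), PROVED**: for every `L`, `0 < b₀`, `2 < p₀` there
are `b₂ = (L² + 6(5L)²)·b₀ ≥ b₀` and `γ₁ = min γ_w (min e^{2(1−p₀)} 1) ∈ (0, 1]` such that for every family `F` with `F.L = L`, every `0 < γ ≤ γ₁`, all `K`,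
`j + 1 ≤ K` and every configuration `U`: `PlaqSmall θ_{b₀}(K−j) (Ū^{j}) → PlaqSmall θ_{b₂}(K−(j+1)) (Ū^{j+1})` — the tree's crude Prop. 1 for the (0.4)
averaging (`plaqSmall_blockAvg_expMeanLogSU`), its guard from the uniform smallness of the thresholds (`exists_forall_θBal_le`), and the monotonicity
`θ(i+1) ≤ θ(i)` below `e^{2(1−p₀)}` (`θBal_succ_le`).  Deterministic; no measure, no tail, nothing about the mass gap.
[cite: Balaban1985Averaging, Prop. 1 (51) p.26; Balaban1985UV3, (7) p.257] -/
theorem firstExitWindow_oneStepWindowL_proof :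
    Summit.QuantumFields.YangMills.Theses.FirstExitWindow.OneStepWindowL := by
  intro L b₀ p₀ hb₀ hp₀
  by_cases hL : 1 ≤ L
  · -- the window factor and the guard target
    set W : ℝ := (L : ℝ) ^ 2 + 6 * (((3 + 2) * L : ℕ) : ℝ) ^ 2 with hW
    have hW1 : 1 ≤ W := one_le_windowFactor hL
    have hW0 : 0 ≤ W := zero_le_one.trans hW1
    have h5 : (0 : ℝ) < (((3 + 2) * L : ℕ) : ℝ) := by exact_mod_cast (by omega : 0 < (3 + 2) * L)
    have hc2 : (0 : ℝ) < (((3 + 2) * L : ℕ) : ℝ) ^ 2 := by positivity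
    have hε : 0 < deltaSU (Fin 2) / (((3 + 2) * L : ℕ) : ℝ) ^ 2 := div_pos deltaSU_pos hc2
    obtain ⟨γw, hγw, hθw⟩ := exists_forall_θBal_le hL b₀ p₀ hε
    have he : 0 < Real.exp (2 * (1 - p₀)) := Real.exp_pos _
    refine ⟨W * b₀, min γw (min (Real.exp (2 * (1 - p₀))) 1), ?_, lt_min hγw (lt_min he one_pos),
      (min_le_right _ _).trans (min_le_right _ _), fun F γ hFL hγ hle K j hjK U hU => ?_⟩
    · -- `b₀ ≤ W·b₀`
      have := mul_le_mul_of_nonneg_right hW1 hb₀.le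
      rwa [one_mul] at this
    · subst hFL
      have hγ1 : γ ≤ 1 := hle.trans ((min_le_right _ _).trans (min_le_right _ _))
      have hγw' : γ ≤ γw := hle.trans (min_le_left _ _)
      have hγe : Real.sqrt γ ≤ Real.exp (1 - p₀) :=
        (sqrt_le_exp_iff hγ.le).mpr (hle.trans ((min_le_right _ _).trans (min_le_left _ _)))
      have hθ0 : 0 ≤ θBal F.L γ b₀ p₀ (K - j) := (θBal_pos hL hγ hγ1 hb₀ p₀ (K - j)).le
      -- the guard of the crude Prop. 1 at `a = θ_{b₀}(K − j)`
      have hguard : ((((F.P K).d + 2) * (F.P K).L : ℕ) : ℝ) ^ 2 / 4 * θBal F.L γ b₀ p₀ (K - j) < deltaSU (Fin 2) := by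
        show (((3 + 2) * F.L : ℕ) : ℝ) ^ 2 / 4 * θBal F.L γ b₀ p₀ (K - j) < deltaSU (Fin 2)
        calc (((3 + 2) * F.L : ℕ) : ℝ) ^ 2 / 4 * θBal F.L γ b₀ p₀ (K - j)
            ≤ (((3 + 2) * F.L : ℕ) : ℝ) ^ 2 / 4 * (deltaSU (Fin 2) / (((3 + 2) * F.L : ℕ) : ℝ) ^ 2) :=
              mul_le_mul_of_nonneg_left (hθw γ hγ hγw' (K - j)) (by positivity)
          _ = deltaSU (Fin 2) / 4 := by field_simp
          _ < deltaSU (Fin 2) := by linarith [deltaSU_pos (n := Fin 2)]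
      -- one (0.4)-averaging step: [Balaban1985Averaging] Prop. 1, crude form
      have hjm : j + 1 ≤ (F.P K).m + (F.P K).K := by
        show j + 1 ≤ F.m + K
        omega
      have hstep := plaqSmall_blockAvg_expMeanLogSU (n := Fin 2) (P := F.P K) (j := j) hjm hθ0 hU hguard
      -- `iter (j+1) U = blockAvg_j (iter j U)`; widen the threshold
      show PlaqSmall (θBal F.L γ (W * b₀) p₀ (K - (j + 1)))
        ((BlockAveraging.blockAvg (P := F.P K) (j := j) ℰp).avg
          (Averaging.iter (fun i => BlockAveraging.blockAvg (P := F.P K) (j := i) ℰp) j U))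
      refine fun p => (hstep p).trans_le ?_
      show (((F.L : ℕ) : ℝ) ^ 2 + 6 * (((3 + 2) * F.L : ℕ) : ℝ) ^ 2) * θBal F.L γ b₀ p₀ (K - j) ≤
        θBal F.L γ (W * b₀) p₀ (K - (j + 1))
      rw [θBal_const_mul, ← hW]
      have hKj : K - j = K - (j + 1) + 1 := by omega
      rw [hKj]
      exact mul_le_mul_of_nonneg_left (θBal_succ_le hL hγ hγ1 hγe hb₀.le (by linarith) (K - (j + 1))) hW0
  · -- no family has block size `L ≤ 0`
    refine ⟨b₀, 1, le_rfl, one_pos, le_rfl, fun F γ hFL => ?_⟩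
    have := F.hL.2
    omega

end Summit.QuantumFields.YangMills.Theorems

end
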